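import Literature.NumberTheory.Automorphic.ResGLnCuspidalCohomologyApexInvariants
import Literature.NumberTheory.Automorphic.ResGLnCuspidalCohomologyApexDegreeZero
import HarnessLib

/-!
# Clozel's Lemme 3.15 (the apex fact) reduced to his Lemme 3.14 read on `W^{K(𝔫)}`

Topic `NumberTheory/Automorphic`; namespace `Literature.NumberTheory.Automorphic.ConeDictionary`;
one theorem (no definition, no named fact, no `sorry`).

The third docking point for the archimedean input of
`ConeDictionary.Clozel1990_exists_basic_levelFixed_cocycle` (after
`…_of_unitary_gkCohomology`, `ResGLnCuspidalCohomologyApexUnitary`, and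
`…_of_irreducible_unitary_gkCohomology`, `ResGLnCuspidalCohomologyApexIrreducible`): the statement
closest to the letter of Clozel 1990, Lemme 3.14 (p. 114) — **for a clean cuspidal `π` of `GL_n(𝔸_K)`
(`W ≤ 𝒜₀`, `W' = ⊥`) whose infinity type is cohomological for `E_λ^∨` and which has a non-zero
`K(𝔫)`-fixed form, some `H^q(𝔤, K_∞; W^{K(𝔫)} ⊗ (E_λ(ℂ) ⊗ ε_S))` is non-zero** ("la cohomologie de
`π_∞ ⊗ ε ⊗ E` ne s'annule pas", computed by Clozel from the classification of the generic unitary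
`π_v` — Speh for `GL_n(ℝ)`, Enright for `GL_n(ℂ)` — and read on the `K(𝔫)`-invariants as in the proof
of Lemme 3.15, p. 121).  Given that statement (hypothesis `H`), the apex fact follows in the tree:
`H⁰ = 0` for modules embedded in the cusp forms turns the class into a non-zero basic cochain of
positive degree (`exists_nonzero_basic_of_nontrivial_cohomology`) and
`Clozel1990_exists_basic_levelFixed_cocycle_of_nonzero_moduleCochain` concludes.
[cite: Clozel1990, Lemme 3.14 (p. 114), Lemme 3.15 (p. 121), §3.5 (p. 123)]
[cite: BorelWallach2000, I §5.1, II Prop. 3.1]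

## References

* L. Clozel, *Motifs et formes automorphes* (1990), Lemme 3.14 (p. 114), Lemme 3.15 (p. 121), §3.5.
  [Clozel1990]
* A. Borel, N. Wallach (2000), I §5.1, II Prop. 3.1 (held). [BorelWallach2000]
* B. Speh, Invent. Math. 71 (1983). [Speh1983]
* T. J. Enright, Duke Math. J. 46 (1979). [Enright1979]
-/

noncomputable section

open scoped TensorProduct Classical _root_.Matrix
open _root_.NumberField _root_.NumberField.InfinitePlace _root_.NumberField.mixedEmbedding IsDedekindDomain

namespace Literature.NumberTheory.Automorphic

namespace ConeDictionary

open ResGLnCohomology RealMatrixGroup Literature.Algebra.Lie.ChevalleyEilenberg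
  Literature.NumberTheory.DiophantineGeometry Literature.Barriers.Langlands

set_option maxHeartbeats 800000 in
-- the towers over the datum are deep (as in the sibling `Apex` files)
/-- **Clozel's Lemme 3.15 (the apex fact) from his Lemme 3.14 read on the `K(𝔫)`-invariants.**  The apex
fact `Clozel1990_exists_basic_levelFixed_cocycle` holds as soon as: for every `n ≥ 2`, number field `K`,
level `𝔫 ≠ 0`, dominant `λ` and clean cuspidal `π` (`W' = ⊥`, `Z = 1 ∈ 𝔤` acting by a scalar) with an
infinity type cohomological for `E_λ^∨` and a non-zero `K(𝔫)`-fixed form, some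
`H^q(𝔤, K_∞; W^{K(𝔫)} ⊗ (E_λ(ℂ) ⊗ ε_S))` is non-zero (Clozel 1990, Lemme 3.14, for the `(𝔤, K_∞)`-module
`W^{K(𝔫)} = π_∞ ⊗ π_f^{K(𝔫)}`, a finite sum of copies of `π_∞`).
[cite: Clozel1990, Lemme 3.14 (p. 114), Lemme 3.15 (p. 121)] [cite: BorelWallach2000, I §5.1, II Prop. 3.1] -/
theorem Clozel1990_exists_basic_levelFixed_cocycle_of_invariants_gkCohomology
    (H : ∀ (n : ℕ) (K : Type) [Field K] [NumberField K] (hcpt : isCompact_glFiniteIntegralLevel n K)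
      (𝔫 : Ideal (𝓞 K)) (lam : (K →+* ℂ) → Fin n → ℤ), 2 ≤ n → ∀ h𝔫 : 𝔫 ≠ 0,
      (∀ τ, Weight.IsDominant (lam τ)) →
      ∀ π : CuspidalAutomorphicRepData n K hcpt, π.1.W' = ⊥ →
        (∃ μ : ℂ, ∀ c ∈ π.1.W, lieDeriv (AutomorphyDatum.gl n K hcpt).ofArch
          (⟨1, trivial⟩ : (AutomorphyDatum.gl n K hcpt).arch.lie) c = μ • c) →
        (∃ T : InfinityType K n, π.1.HasInfinityType T ∧
          ∀ τ : K →+* ℂ, (T τ).map ArchWeight.a =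
            (cohomologicalInfinityType n K (Weight.dual (lam τ)) τ).map ArchWeight.a) →
        (∃ φ ∈ π.1.W, φ ≠ 0 ∧
          ∀ u ∈ principalCongruenceLevel n K 𝔫, rightTranslation (AdelicGroupData.gl n K) u φ = φ) →
        ∃ (S : Finset {w : InfinitePlace K // w.IsReal}) (q : ℕ),
          Nontrivial ((gkComplexV (invKRep π.1 h𝔫) (invLie π.1 h𝔫) (inv_ad_compat π.1 h𝔫) S lam).Cohomology q)) :
    Clozel1990_exists_basic_levelFixed_cocycle := by
  refine Clozel1990_exists_basic_levelFixed_cocycle_of_nonzero_moduleCochain ?_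
  intro n K _ _ hcpt 𝔫 lam hn h𝔫 hdom π hW' hμ hT hφ
  have hH := H n K hcpt 𝔫 lam hn h𝔫 hdom π hW' hμ hT hφ
  obtain ⟨S, q, hcoh⟩ := hH
  -- `Z` acts on `W^{K(𝔫)}` by a scalar
  obtain ⟨μ, hμ'⟩ := hμ
  have ha : ∀ v : invW π.1 h𝔫, invLie π.1 h𝔫 (centerOne n K hcpt) v = μ • v := invLie_centerOne π.1 h𝔫 hμ'
  -- a non-zero basic cochain of positive degree
  have hb := exists_nonzero_basic_of_nontrivial_cohomology (inv_ad_compat π.1 h𝔫) S lam hn π hW'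
    (j := (invW π.1 h𝔫).subtype) (fun X => subtype_comp_invLie π.1 h𝔫 X) (invW π.1 h𝔫).injective_subtype ha hcoh
  obtain ⟨q', z, hz, hins, hne⟩ := hb
  refine ⟨S, invW π.1 h𝔫, inferInstance, inferInstance, invKRep π.1 h𝔫, invLie π.1 h𝔫,
    inv_ad_compat π.1 h𝔫, (invW π.1 h𝔫).subtype, subtype_comp_invKRep π.1 h𝔫,
    subtype_comp_invLie π.1 h𝔫, (invW π.1 h𝔫).injective_subtype, levelProj_coe_invW π.1 h𝔫, q', z, hz, ?_, hne⟩
  exact hins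

end ConeDictionary

end Literature.NumberTheory.Automorphic

end
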